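import Summits.AnomalousDissipation.AnomalousDissipation.Theorems.SolenoidalFractalHomogenisationLagrangianStepVmodFlatBlocksEVH
import HarnessLib

/-!
# K1L_D (stmt-AnomalousDissipation-27980): (V_mod) FLAT STAGE — the (sf) block REDUCED TO A PER-LABEL SIDEBAND TEXT `SFMode_textEVH`
# (prover ad-k3l-bookkeeping-p1 g10, (sf) owner by tenure RULING D28-5; `--kind definition --supports 27980 --as helper`; definition only)

The (sf) block `Bsf_textEVH e` (`…VmodFlatBlocksEVH`, binder list of RULING D27-12) asks, for SLOW data `x` and FAST tests `ζ` at resolution `n` and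
ALL windows `0 ≤ s < t ≤ Tw`, `|⟪(U−T)(s,t)x, ζ⟫| ≤ η(t−s)·√q_T(x)·√q*_T(ζ)`.  Since the coarse member keeps `x` slow (F0), the pairing is the SIDEBAND
`⟪U(s,t)x, ζ⟫` of the cell flow on slow data.  Two rows: SHORT windows `t − s ≤ P := M·W.period/ν` are the tree theorem
`VmodFlat.short_pairing_le_of_fast` (ad-k3l g9, transport duality, no (V)/W7); LONG windows `P < t − s` are, class pair by class pair
(`…VmodSfAssembly.abs_inner_sub_le_sqrt_of_slow_sideband`, p716711), the text typed HERE: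

* **`SFMode_textEVH e`** — binder list of `Bsf_textEVH e` VERBATIM (guards, `(C)`, (V) `SlowVectorClauseF …`, the W7 family) ⟹ `∃ C₂ ≥ 0` such that,
  in the regime of `BlockBound` (cell member `U`, coarse member `T` on `[0,Tw]`, both tensor windows), for every LONG window `M·W.period/ν < t − s`
  (general phase `s` — load-bearing: ad-k3l g9's `bffEVH_of_bsfEVH` consumes (sf) at the energy-inequality good time), every nonzero slow label
  `ℓ ∈ (freqBall (n/4)).erase 0`, every weakly divergence-free `w` carried by `{ℓ, −ℓ}` and every FAST test `ζ`:
  `|⟪U s t w, ζ⟫| ≤ η(t−s) · √(dW lo Λ c ν n (t−s) ℓ) · ‖w‖ · ‖ζ‖`,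
  `η = C₂(C₂(ν^{eσ} + (⌈K/ν⌉/n)^{eσ}) + min(1, P/(t−s))^{eσ})` (the `BlockBound` allowance), `dW` = the modewise coarse-loss weight of `…VmodSSReduce`.
Per the certifier's table (`Cruxes/LagrangianRenormalisationStep/Lines/onelevel-ss-regimes.md` §4 (sf)) the coarse labels (`‖ℓ‖⌈K/ν⌉ ≤ g₀ n`) consume
(V) through the grid iteration T-I (sideband slaved to the slow amplitude, which decays only by iterated (V)), the high labels consume W7; the coarse
member `T` is offered to the prover because (V) is a `U`-vs-`T` statement.  The reduction `bsf_of_sfMode : SFMode_textEVH e → Bsf_textEVH e` is the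
companion proof file `…VmodSfReduce`.  Definition only; NOT a proof of (sf), of `stub_Vmod_EHT`, of K1L_D or AD; rung F-D1.A0.
-/

set_option linter.dupNamespace false

noncomputable section

namespace Summit.AnomalousDissipation.AnomalousDissipation.Theorems.SolenoidalFractalHomogenisation.LagrangianStep.VmodFlat

open Literature.Analysis Literature.Analysis.FluidPDE Literature.Analysis.FunctionSpaces
open MeasureTheory Set Filter UnitAddTorus
open scoped ENNReal NNReal InnerProductSpace
open Summit.AnomalousDissipation.AnomalousDissipation.Theorems.SolenoidalFractalHomogenisation.LagrangianStep.CellClauseMod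

/-- **(sf-mode)EVH — THE PER-LABEL SIDEBAND TARGET of the (sf) block on LONG windows** (binder list of `Bsf_textEVH`, RULING D27-12; inner
regime = `BlockBound`'s plus `M·W.period/ν < t − s`): for every nonzero slow label `ℓ`, every weakly divergence-free pair datum `w` carried by
`{ℓ, −ℓ}` and every fast test `ζ`, `|⟪U s t w, ζ⟫| ≤ η(t−s)·√(dW … (t−s) ℓ)·‖w‖·‖ζ‖` with the `BlockBound` allowance `η` at output exponent `e σ`. -/
def SFMode_textEVH (e : ℝ → ℝ) : Prop := ∀ k (W : LatticeShear.LatticeWord k) (M : ℝ) (hM : 0 < M) (c : ℝ), 0 < c →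
  ∀ (Φ : ℝ → Torus.Visc4 (Fin 3) → Torus.Visc4 (Fin 3)) (lo hi Λ β σ C ν₀ K : ℝ),
    0 < lo → lo ≤ 1 → 1 ≤ hi → 1 < Λ → 0 ≤ β → 0 < σ → 0 ≤ C → 0 < ν₀ → ν₀ ≤ 1 → 0 < K →
    SlowVectorClauseF W M hM c Φ lo hi Λ β σ C ν₀ K →
    (∀ Kb : ℝ, 1 ≤ Kb → ∃ CK : ℝ, 1 ≤ CK ∧ ∃ cK > (0:ℝ), ∃ νh > (0:ℝ), HighLabelDecayW W M hM lo hi Λ β νh Kb CK cK) →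
    ∃ C₂ : ℝ, 0 ≤ C₂ ∧
    ∀ ν, ∀ hν : ν ∈ Set.Ioo 0 ν₀, ∀ n : ℕ, (⌈K / ν⌉₊ : ℝ) ≤ n → ∀ 𝔸 : Torus.Visc4 (Fin 3),
      Torus.OddSmall 𝔸 (ν * β) → (∃ lam ∈ Set.Icc (1:ℝ) Λ, Torus.NearIso 𝔸 (ν * (lo / lam)) (ν * (hi * lam))) →
      Torus.OddSmall (Φ ν ((1 / ν) • 𝔸)) β → (∃ lam ∈ Set.Icc (1:ℝ) Λ, Torus.NearIso (Φ ν ((1 / ν) • 𝔸)) (lo / lam) (hi * lam)) →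
      ∀ Tw > (0:ℝ), ∀ U T : ℝ → ℝ → (V2 →L[ℝ] V2),
        Torus.IsPropagator Tw (cellField W M hM ν hν.1 n) ((1 / (n:ℝ) ^ 2) • 𝔸) U →
        Torus.IsPropagator Tw (fun _ _ => 0) ((1 / (n:ℝ) ^ 2) • (𝔸 + (c / ν) • Φ ν ((1 / ν) • 𝔸))) T →
      ∀ s t : ℝ, 0 ≤ s → s < t → t ≤ Tw → M * W.period / ν < t - s →
      ∀ ℓ ∈ (Torus.freqBall (d := Fin 3) (n / 4)).erase 0, ∀ w : V2, w ∈ Torus.divFreeL2 (Fin 3) →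
        (∀ k', k' ≠ ℓ → k' ≠ -ℓ → fc w k' = 0) → ∀ ζ : V2, IsFast n ζ →
        |⟪U s t w, ζ⟫_ℝ|
          ≤ (C₂ * (C₂ * (ν ^ e σ + ((⌈K / ν⌉₊ : ℝ) / n) ^ e σ) + (min 1 ((M * W.period / ν) / (t - s))) ^ e σ))
            * Real.sqrt (dW lo Λ c ν n (t - s) ℓ) * ‖w‖ * ‖ζ‖

/-- Degenerate-instance check: the text is monotone in the exponent map only through `e σ`; at a window where the sideband VANISHES (e.g. `U s t w`
slow) the inequality holds for every `C₂ ≥ 0` — the right-hand side is nonnegative. -/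
theorem sfMode_rhs_nonneg {C₂ ν a b m d : ℝ} (hC₂ : 0 ≤ C₂) (hν : 0 ≤ ν) (ha : 0 ≤ a) (hm : 0 ≤ m) (e : ℝ) (w ζ : V2) :
    0 ≤ (C₂ * (C₂ * (ν ^ e + a ^ e) + (min 1 m) ^ e)) * Real.sqrt (b * d) * ‖w‖ * ‖ζ‖ := by
  have h1 : 0 ≤ ν ^ e := Real.rpow_nonneg hν e
  have h2 : 0 ≤ a ^ e := Real.rpow_nonneg ha e
  have h3 : 0 ≤ (min 1 m) ^ e := Real.rpow_nonneg (le_min zero_le_one hm) e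
  positivity

end Summit.AnomalousDissipation.AnomalousDissipation.Theorems.SolenoidalFractalHomogenisation.LagrangianStep.VmodFlat

end
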